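import Summits.AtomisticToContinuum.Crystallization.Theorems.FrustratedLawDichotomyStrainedPatchFrameCellsB

/-!
# «FrameCells» (lens-5 g65 rev 3, 27623 T-side: frame charts, exact riding as a frame relation, frame cells / InFrameCells / FrameCellsCert, presented nets and the net theorem tubeP_of_frameNet_WSym, the frame loose witness and the HOLE TEST HoleAt/FixedHoleAt) — part 3 of 3 (sequel of `…FrustratedLawDichotomyStrainedPatchFrameCellsB`)

Split for the 400-line cap by the landing lane (hand-2 g30); the module docstring of part 1 (`…FrustratedLawDichotomyStrainedPatchFrameCellsA`) describes the whole node.  Same namespace; all FQNs unchanged.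
0 sorry; standard axioms.
-/

noncomputable section

namespace Summit.AtomisticToContinuum.Crystallization.Theorems.FrustratedLawDichotomyStrainedPatchFrameCells

open scoped BigOperators Classical RealInnerProductSpace
open Literature.Geometry.DiscreteGeometry (fccKissingPattern hcpKissingPattern card_fccKissingPattern card_hcpKissingPattern
  norm_eq_one_of_mem_fccKissingPattern norm_eq_one_of_mem_hcpKissingPattern one_le_dist_of_mem_fccKissingPattern one_le_dist_of_mem_hcpKissingPattern)
open Summit.AtomisticToContinuum.Crystallization.Theorems.FrustratedLawDichotomyPeriodicBlockFlags (goodAtScale_mono)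
open Summit.AtomisticToContinuum.Crystallization.Theorems.FrustratedLawDichotomyRangeCut (Sep)
open Summit.AtomisticToContinuum.Crystallization.Theorems.FrustratedLawDichotomyMotifLemmas
open Summit.AtomisticToContinuum.Crystallization.Theorems.FrustratedLawDichotomyAveragingCut
open Summit.AtomisticToContinuum.Crystallization.Theorems.FrustratedLawDichotomyAveragingRuleCap
open Summit.AtomisticToContinuum.Crystallization.Theorems.FrustratedLawDichotomyAveragingRuleTightFree
open Summit.AtomisticToContinuum.Crystallization.Theorems.FrustratedLawDichotomyExemptDoor (SitePred)
open Summit.AtomisticToContinuum.Crystallization.Theorems.FrustratedLawDichotomyExemptAbsorption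
open Summit.AtomisticToContinuum.Crystallization.Theorems.FrustratedLawDichotomyExemptAbsorptionRecord
open Summit.AtomisticToContinuum.Crystallization.Theorems.FrustratedLawDichotomyCollarCensus
open Summit.AtomisticToContinuum.Crystallization.Theorems.FrustratedLawDichotomyCollarCensusKappa
open Summit.AtomisticToContinuum.Crystallization.Theorems.FrustratedLawDichotomyStrainedPatchHomSplit
open Summit.AtomisticToContinuum.Crystallization.Theorems.FrustratedLawDichotomyStrainedPatchCleanCollar
open Summit.AtomisticToContinuum.Crystallization.Theorems.FrustratedLawDichotomyStrainedPatchHomTube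
open Summit.AtomisticToContinuum.Crystallization.Theorems.FrustratedLawDichotomyStrainedPatchHomPolar
open Summit.AtomisticToContinuum.Crystallization.Theorems.FrustratedLawDichotomyStrainedPatchHomIsometry
open Summit.AtomisticToContinuum.Crystallization.Theorems.FrustratedLawDichotomyStrainedPatchHomTubeIso
open Summit.AtomisticToContinuum.Crystallization.Theorems.FrustratedLawDichotomyStrainedPatchPhaseCut
open Summit.AtomisticToContinuum.Crystallization.Theorems.FrustratedLawDichotomyStrainedPatchCoreTube
open Summit.AtomisticToContinuum.Crystallization.Theorems.FrustratedLawDichotomyStrainedPatchCoreTubeRecord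
open Summit.AtomisticToContinuum.Crystallization.Theorems.FrustratedLawDichotomyStrainedPatchCoreTubeMilli
open Summit.AtomisticToContinuum.Crystallization.Theorems.FrustratedLawDichotomyStrainedPatchStrainBands
open Summit.AtomisticToContinuum.Crystallization.Theorems.FrustratedLawDichotomyStrainedPatchChartFamilies
open Summit.AtomisticToContinuum.Crystallization.Theorems.FrustratedLawDichotomyStrainedPatchChartFamiliesBent
open Summit.AtomisticToContinuum.Crystallization.Theorems.FrustratedLawDichotomyStrainedPatchChartFamiliesPinned
open Summit.AtomisticToContinuum.Crystallization.Theorems.FrustratedLawDichotomyStrainedPatchRecutPairs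
open Summit.AtomisticToContinuum.Crystallization.Theorems.FrustratedLawDichotomyStrainedPatchRecutKinematics
open Summit.AtomisticToContinuum.Crystallization.Theorems.FrustratedLawDichotomyStrainedPatchWindowFamilies
open Summit.AtomisticToContinuum.Crystallization.Theorems.FrustratedLawDichotomyStrainedPatchHostCells
open Summit.AtomisticToContinuum.Crystallization.Theorems.FrustratedLawDichotomyStrainedPatchGaugeCells

/-! ## §3. THE FRAME LOOSE WITNESS AND THE HOLE TEST — a dead-cell instrument that USES ORIENTATION (bond witnesses cannot) -/

section Loose
variable {M₁ : ℕ} {z₁ : Fin M₁ → E3} {c₁ a₁ : Fin M₁} {τ τ' : ℝ} {M : ℕ} {z : Fin M → E3} {c : Fin M} {e' : Fin M → Fin M₁}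

/-- **`FrameLooseWitness z₁ c₁ τ a₁` [WITNESS · frame currency]** — the reference site `a₁` CANNOT BE `1/8`-GOOD IN ANY FRAME-CHARTED CLUSTER: whatever
admissible clean mono-phase cluster the reference frame-charts with tolerance `τ`, the cluster site labelled `a₁` is not `GoodAtScale (1/8) (3/2)`.  The frame
twin of 63G's `LooseWitness z₁ c₁ τ 0 0 a₁`, and WEAKER (implied by it: `frameLooseWitness_of_looseWitness`) — it may use the relative POSITIONS of the sites
around `a₁`, not only their distances. -/
def FrameLooseWitness {M₁ : ℕ} (z₁ : Fin M₁ → E3) (c₁ : Fin M₁) (τ : ℝ) (a₁ : Fin M₁) : Prop :=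
  ∀ (M : ℕ) (z : Fin M → E3) (c : Fin M) (e' : Fin M → Fin M₁), FrameCharted z₁ c₁ τ M z c e' →
    ∀ a, dist (z a) (z c) ≤ 63 / 10 → e' a = a₁ → ¬GoodAtScale (1 / 8) (3 / 2) z a

/-- ★★ **THE DEAD JUNCTION, frame currency**: a frame loose witness at a reference site of the `6`-ball makes the reference frame-DEAD — the cover clause puts a
cluster site of the `63/10`-ball on the label `a₁`, admissibility (A2) makes that site `1/8`-good, the witness says it is not. [folklore] -/
theorem frameDeadRef_of_frameLooseWitness (ha₁ : dist (z₁ a₁) (z₁ c₁) ≤ 6) (hW : FrameLooseWitness z₁ c₁ τ a₁) : FrameDeadRef z₁ c₁ τ := by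
  intro M z c e' hch
  obtain ⟨a, ha, hea⟩ := hch.2.2.2.2.2.2 a₁ ha₁
  exact hW M z c e' hch a ha hea (hch.2.1 a ha)

/-- … hence certifies the cell. [formal bookkeeping] -/
theorem frameTubeFloor_of_frameLooseWitness (ha₁ : dist (z₁ a₁) (z₁ c₁) ≤ 6) (hW : FrameLooseWitness z₁ c₁ τ a₁) : FrameTubeFloor z₁ c₁ τ :=
  frameTubeFloor_of_frameDeadRef (frameDeadRef_of_frameLooseWitness ha₁ hW)

/-- 63G's bond loose witness is a frame loose witness (so (R12)/(N13)/(K13) feed the frame junction too). [formal bookkeeping] -/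
theorem frameLooseWitness_of_looseWitness (h : LooseWitness z₁ c₁ τ 0 0 a₁) : FrameLooseWitness z₁ c₁ τ a₁ :=
  fun M z c e' hch a ha hea => h M z c e' (charted_of_frameCharted hch) a ha hea

/-- Frame loose witnesses are ANTITONE in the tolerance. [formal bookkeeping] -/
theorem FrameLooseWitness.anti (h : FrameLooseWitness z₁ c₁ τ' a₁) (hle : τ ≤ τ') : FrameLooseWitness z₁ c₁ τ a₁ :=
  fun M z c e' hch a ha hea => h M z c e' (hch.mono hle) a ha hea

/-- **(HT) `HoleAt P z₁ c₁ a₁ τ` — THE HOLE TEST [WITNESS LEAF · DECIDABLE on the reference · pattern `P`]**: for every CANDIDATE CENTRE `q₀` within `τ` of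
`z₁ a₁`, every scale `0 < d ≤ 3/2` and every orientation `A` (a linear isometry) that are PINNED by the reference — every other reference site of the `6`-ball at
distance `≥ d − τ` from `q₀`, some other reference site at distance `≤ d + τ` — SOME vertex `q₀ + d·A(P u)` of the candidate `P`-shell is a HOLE: no other
reference site within `d/8 + τ` of it.  Purely a statement about the finite configuration `z₁`; quantifier shape `∀ (q₀, d, A) ∈` compact semialgebraic `⊂ ℝ³ × ℝ × O(3)`,
`∃ u`, `∀ b` — a `7`-parameter branch-and-bound per cell (the fixed-centre form `FixedHoleAt`, `4` parameters, implies it: `holeAt_of_fixedHoleAt`). -/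
def HoleAt {ι : Type*} (P : ι → E3) {M₁ : ℕ} (z₁ : Fin M₁ → E3) (c₁ a₁ : Fin M₁) (τ : ℝ) : Prop :=
  ∀ (q₀ : E3) (d : ℝ) (A : E3 →ₗᵢ[ℝ] E3), dist q₀ (z₁ a₁) ≤ τ → 0 < d → d ≤ 3 / 2 →
    (∀ b, b ≠ a₁ → dist (z₁ b) (z₁ c₁) ≤ 6 → d ≤ dist (z₁ b) q₀ + τ) →
    (∃ b, b ≠ a₁ ∧ dist (z₁ b) q₀ ≤ d + τ) →
      ∃ u, ∀ b, b ≠ a₁ → d / 8 + τ ≤ dist (z₁ b) (q₀ + d • A (P u))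

/-- The hole test is ANTITONE in the tolerance. [formal bookkeeping] -/
theorem HoleAt.anti {ι : Type*} {P : ι → E3} (h : HoleAt P z₁ c₁ a₁ τ') (hle : τ ≤ τ') : HoleAt P z₁ c₁ a₁ τ := by
  intro q₀ d A hq hd hdD hpin hpin'
  obtain ⟨u, hu⟩ := h q₀ d A (hq.trans hle) hd hdD (fun b hb hb6 => (hpin b hb hb6).trans (by linarith))
    (hpin'.imp fun b hb => ⟨hb.1, hb.2.trans (by linarith)⟩)
  exact ⟨u, fun b hb => by linarith [hu b hb]⟩

/-- ★★★ **THE HOLE TEST KILLS THE FIT** (one pattern): if the reference passes (HT) at `a₁` for the pattern `P` (unit vectors) and `a₁` has ROOM — for some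
other reference site `s₁` of the `6`-ball, `d(z₁ a₁, z₁ c₁) + τ + 9/8·(d(z₁ s₁, z₁ a₁) + 2τ) ≤ 63/10` (the label of `s₁` pins the cluster scale: `d ≤ ρ₁ + 2τ`, so the
whole `9d/8`-shell of the cluster site is inside the charted `63/10`-ball; the (R12) room of g64) — then in NO frame-charted cluster is the site labelled `a₁`
`P`-fit at pinned scale with misfit `< 1/8`.
PROOF. Read the fit `(d, A, pinned d)` of the cluster site `a` in the reference frame through the chart: the candidate centre `q₀ := (z a − z c) + z₁ c₁` is within `τ`
of `z₁ a₁`; every cluster site `j` of the ball satisfies `|d(z j, z a) − d(z₁ (e' j), q₀)| ≤ τ` (frame clause at `j` and at `a`), so the cluster's pins transport to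
the reference's pins about `q₀` (cover clause for `∀`, injectivity on the ball for `≠ a₁`); the twelve shell sites `k u` have labels `≠ a₁` within `ηd + τ < d/8 + τ`
of the vertices `q₀ + d·A(P u)` (frame clause at `k u` — a VECTOR statement: this is where orientation is used) — contradicting the hole. [new] -/
theorem no_fit_of_holeAt {ι : Type*} (P : ι → E3) (hP1 : ∀ u, ‖P u‖ = 1) {s₁ : Fin M₁} (hs₁ : s₁ ≠ a₁) (hs₆ : dist (z₁ s₁) (z₁ c₁) ≤ 6)
    (hroom : dist (z₁ a₁) (z₁ c₁) + τ + 9 / 8 * (dist (z₁ s₁) (z₁ a₁) + 2 * τ) ≤ 63 / 10)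
    (hH : HoleAt P z₁ c₁ a₁ τ) (hch : FrameCharted z₁ c₁ τ M z c e') {a : Fin M} (ha : dist (z a) (z c) ≤ 63 / 10) (hea : e' a = a₁)
    (hfit : FitAtScale P (1 / 8) (3 / 2) z a) : False := by
  obtain ⟨hz, -, -, -, hpos, hinj, hcov⟩ := hch
  have hy : Function.Injective z := hz.1
  obtain ⟨d, η, γ, A, hdD, t, hd, -, hη, hT, hpin, hpin', -⟩ := hfit
  choose k hk using fun u => (hT u).1
  have hfitu : ∀ u, ‖(z (k u) - z a) - d • A (P u)‖ ≤ η * d := fun u => by rw [hk u]; exact (hT u).2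
  have hnd : ∀ u, ‖d • A (P u)‖ = d := fun u => by
    rw [norm_smul, LinearIsometry.norm_map, hP1, mul_one, Real.norm_of_nonneg hd.le]
  have hηd : η * d < d / 8 := by nlinarith
  -- the candidate centre: the position of `a`, read in the reference frame
  set q₀ : E3 := z a - z c + z₁ c₁ with hq₀
  have hpa : dist (z a - z c) (z₁ a₁ - z₁ c₁) ≤ τ := by rw [← hea]; exact hpos a ha
  have hq₀a : dist q₀ (z₁ a₁) ≤ τ := by
    have h₁ : dist q₀ (z₁ a₁) = dist (z a - z c) (z₁ a₁ - z₁ c₁) := by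
      rw [hq₀, dist_eq_norm, dist_eq_norm]
      congr 1
      abel
    rw [h₁]
    exact hpa
  -- the frame reading: distances to `a` in the cluster = distances to `q₀` in the reference, up to `τ`
  have hkey : ∀ j, dist (z j) (z c) ≤ 63 / 10 → |dist (z j) (z a) - dist (z₁ (e' j)) q₀| ≤ τ := by
    intro j hj
    have h₁ := hpos j hj
    rw [dist_eq_norm] at h₁
    rw [dist_eq_norm, dist_eq_norm]
    have h₂ : (z j - z a) - (z₁ (e' j) - q₀) = (z j - z c) - (z₁ (e' j) - z₁ c₁) := by rw [hq₀]; abel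
    calc |‖z j - z a‖ - ‖z₁ (e' j) - q₀‖| ≤ ‖(z j - z a) - (z₁ (e' j) - q₀)‖ := abs_norm_sub_norm_le _ _
      _ = ‖(z j - z c) - (z₁ (e' j) - z₁ c₁)‖ := by rw [h₂]
      _ ≤ τ := h₁
  have hac : dist (z a) (z c) ≤ dist (z₁ a₁) (z₁ c₁) + τ := by
    rw [dist_eq_norm] at hpa ⊢
    rw [dist_eq_norm]
    calc ‖z a - z c‖ = ‖(z₁ a₁ - z₁ c₁) + ((z a - z c) - (z₁ a₁ - z₁ c₁))‖ := by rw [add_sub_cancel]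
      _ ≤ ‖z₁ a₁ - z₁ c₁‖ + ‖(z a - z c) - (z₁ a₁ - z₁ c₁)‖ := norm_add_le _ _
      _ ≤ ‖z₁ a₁ - z₁ c₁‖ + τ := by linarith
  -- the cluster's `∀`-pin transports to the reference's pin about `q₀`; in particular the label of `s₁` caps the scale
  have hpinR : ∀ b, b ≠ a₁ → dist (z₁ b) (z₁ c₁) ≤ 6 → d ≤ dist (z₁ b) q₀ + τ := by
    intro b hb hb6
    obtain ⟨j, hj, hej⟩ := hcov b hb6
    have hja : j ≠ a := fun h₁ => hb (by rw [← hej, h₁, hea])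
    have h₁ : d ≤ dist (z j) (z a) := hpin (z j) ⟨j, rfl⟩ (hy.ne hja)
    have h₂ := hkey j hj
    rw [hej] at h₂
    linarith [(abs_sub_le_iff.1 h₂).1]
  have hdρ : d ≤ dist (z₁ s₁) (z₁ a₁) + 2 * τ := by
    have h₁ := hpinR s₁ hs₁ hs₆
    have h₂ := dist_triangle (z₁ s₁) (z₁ a₁) q₀
    rw [dist_comm (z₁ a₁) q₀] at h₂
    linarith
  -- the shell sites are ball sites, distinct from `a`, with labels `≠ a₁` near the candidate vertices
  have hshell : ∀ u, dist (z (k u)) (z a) ≤ 9 / 8 * (dist (z₁ s₁) (z₁ a₁) + 2 * τ) := fun u => by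
    rw [dist_eq_norm]
    calc ‖z (k u) - z a‖ = ‖((z (k u) - z a) - d • A (P u)) + d • A (P u)‖ := by rw [sub_add_cancel]
      _ ≤ ‖(z (k u) - z a) - d • A (P u)‖ + ‖d • A (P u)‖ := norm_add_le _ _
      _ ≤ η * d + d := add_le_add (hfitu u) (hnd u).le
      _ ≤ 9 / 8 * (dist (z₁ s₁) (z₁ a₁) + 2 * τ) := by linarith
  have hball : ∀ u, dist (z (k u)) (z c) ≤ 63 / 10 := fun u => by linarith [hshell u, dist_triangle (z (k u)) (z a) (z c)]
  have hka : ∀ u, k u ≠ a := by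
    intro u hu
    have h₁ := hfitu u
    rw [hu, sub_self, zero_sub, norm_neg, hnd] at h₁
    linarith
  have hba : ∀ u, e' (k u) ≠ a₁ := fun u h₁ => hka u (hinj (k u) a (hball u) ha (h₁.trans hea.symm))
  have htarget : ∀ u, dist (z₁ (e' (k u))) (q₀ + d • A (P u)) < d / 8 + τ := by
    intro u
    have h₁ := hpos (k u) (hball u)
    rw [dist_eq_norm] at h₁
    rw [dist_eq_norm]
    have h₂ : z₁ (e' (k u)) - (q₀ + d • A (P u)) = ((z (k u) - z a) - d • A (P u)) - ((z (k u) - z c) - (z₁ (e' (k u)) - z₁ c₁)) := by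
      rw [hq₀]; abel
    rw [h₂]
    calc ‖((z (k u) - z a) - d • A (P u)) - ((z (k u) - z c) - (z₁ (e' (k u)) - z₁ c₁))‖
        ≤ ‖(z (k u) - z a) - d • A (P u)‖ + ‖(z (k u) - z c) - (z₁ (e' (k u)) - z₁ c₁)‖ := norm_sub_le _ _
      _ ≤ η * d + τ := add_le_add (hfitu u) h₁
      _ < d / 8 + τ := by linarith
  -- the cluster's `∃`-pin transports too
  have hpinR' : ∃ b, b ≠ a₁ ∧ dist (z₁ b) q₀ ≤ d + τ := by
    obtain ⟨s, ⟨j₀, rfl⟩, hj₀a, hj₀⟩ := hpin'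
    have hja : j₀ ≠ a := fun h₁ => hj₀a (congrArg z h₁)
    have hj₀ball : dist (z j₀) (z c) ≤ 63 / 10 := by linarith [dist_triangle (z j₀) (z a) (z c)]
    refine ⟨e' j₀, fun h₁ => hja (hinj j₀ a hj₀ball ha (h₁.trans hea.symm)), ?_⟩
    linarith [(abs_sub_le_iff.1 (hkey j₀ hj₀ball)).2]
  obtain ⟨u, hu⟩ := hH q₀ d A hq₀a hd hdD hpinR hpinR'
  exact absurd (hu (e' (k u)) (hba u)) (not_le.2 (htarget u))

/-- ★★★ **(HT) at both patterns ⟹ the frame loose witness** (a `1/8`-good site is fcc- or hcp-fit at pinned scale: `goodAtScale_iff_fcc_or_hcp`). [new] -/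
theorem frameLooseWitness_of_holeAt {s₁ : Fin M₁} (hs₁ : s₁ ≠ a₁) (hs₆ : dist (z₁ s₁) (z₁ c₁) ≤ 6)
    (hroom : dist (z₁ a₁) (z₁ c₁) + τ + 9 / 8 * (dist (z₁ s₁) (z₁ a₁) + 2 * τ) ≤ 63 / 10)
    (hF : HoleAt (fun u : ↥fccKissingPattern => (u : E3)) z₁ c₁ a₁ τ) (hH : HoleAt (fun u : ↥hcpKissingPattern => (u : E3)) z₁ c₁ a₁ τ) :
    FrameLooseWitness z₁ c₁ τ a₁ := by
  intro M z c e' hch a ha hea hgood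
  rcases goodAtScale_iff_fcc_or_hcp.1 hgood with h | h
  · exact no_fit_of_holeAt _ (fun u => norm_eq_one_of_mem_fccKissingPattern u.2) hs₁ hs₆ hroom hF hch ha hea h
  · exact no_fit_of_holeAt _ (fun u => norm_eq_one_of_mem_hcpKissingPattern u.2) hs₁ hs₆ hroom hH hch ha hea h

/-- ★★★ **THE HOLE TEST DECIDES THE CELL**: (HT) for both patterns at a reference site of the `6`-ball with room ⟹ the reference is frame-DEAD ⟹ (FTᶠ). [new] -/
theorem frameDeadRef_of_holeAt (ha₁ : dist (z₁ a₁) (z₁ c₁) ≤ 6) {s₁ : Fin M₁} (hs₁ : s₁ ≠ a₁) (hs₆ : dist (z₁ s₁) (z₁ c₁) ≤ 6)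
    (hroom : dist (z₁ a₁) (z₁ c₁) + τ + 9 / 8 * (dist (z₁ s₁) (z₁ a₁) + 2 * τ) ≤ 63 / 10)
    (hF : HoleAt (fun u : ↥fccKissingPattern => (u : E3)) z₁ c₁ a₁ τ) (hH : HoleAt (fun u : ↥hcpKissingPattern => (u : E3)) z₁ c₁ a₁ τ) :
    FrameDeadRef z₁ c₁ τ :=
  frameDeadRef_of_frameLooseWitness ha₁ (frameLooseWitness_of_holeAt hs₁ hs₆ hroom hF hH)

/-- `frameTubeFloor_of_holeAt` (docstring: see `frameDeadRef_of_holeAt`). [formal bookkeeping] -/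
theorem frameTubeFloor_of_holeAt (ha₁ : dist (z₁ a₁) (z₁ c₁) ≤ 6) {s₁ : Fin M₁} (hs₁ : s₁ ≠ a₁) (hs₆ : dist (z₁ s₁) (z₁ c₁) ≤ 6)
    (hroom : dist (z₁ a₁) (z₁ c₁) + τ + 9 / 8 * (dist (z₁ s₁) (z₁ a₁) + 2 * τ) ≤ 63 / 10)
    (hF : HoleAt (fun u : ↥fccKissingPattern => (u : E3)) z₁ c₁ a₁ τ) (hH : HoleAt (fun u : ↥hcpKissingPattern => (u : E3)) z₁ c₁ a₁ τ) :
    FrameTubeFloor z₁ c₁ τ :=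
  frameTubeFloor_of_frameDeadRef (frameDeadRef_of_holeAt ha₁ hs₁ hs₆ hroom hF hH)

/-- ★★ **(R12) ⟹ (HT)**: g64's radial count witness implies the hole test — if FEWER THAN TWELVE reference sites other than `a₁` lie within `9/8·(ρ₁ + 2τ) + 2τ` of
`z₁ a₁` (`ρ₁ = d(z₁ s₁, z₁ a₁)` for the pinning neighbour `s₁`; literally `…ShellWitness.FewNear z₁ a₁ (9/8·(ρ₁ + 2τ) + 2τ) 12` unfolded), then every pinned
candidate shell about every candidate centre has a hole: else the twelve occupied `(d/8 + τ)`-balls about the vertices (pairwise `≥ d` apart, so the occupants are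
distinct once `14τ ≤ 3 m₁`, `m₁` = the least distance from `z₁ a₁` to another reference site) give twelve such sites.  So the frame instrument (HT) decides AT
LEAST the cells (R12) decides, for unit patterns with twelve `1`-separated vectors. [new] -/
theorem holeAt_of_fewNear {ι : Type*} [Fintype ι] (P : ι → E3) (hcard : Fintype.card ι = 12) (hP1 : ∀ u, ‖P u‖ = 1)
    (hPsep : ∀ u v, u ≠ v → 1 ≤ dist (P u) (P v)) {s₁ : Fin M₁} (hs₁ : s₁ ≠ a₁) (hs₆ : dist (z₁ s₁) (z₁ c₁) ≤ 6)
    {m₁ : ℝ} (hm : ∀ b, b ≠ a₁ → m₁ ≤ dist (z₁ b) (z₁ a₁)) (hmτ : 14 * τ ≤ 3 * m₁)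
    (hcount : ∀ S : Finset (Fin M₁), (∀ b₁ ∈ S, b₁ ≠ a₁ ∧ dist (z₁ b₁) (z₁ a₁) ≤ 9 / 8 * (dist (z₁ s₁) (z₁ a₁) + 2 * τ) + 2 * τ) → S.card < 12) :
    HoleAt P z₁ c₁ a₁ τ := by
  intro q₀ d A hq hd hdD hpin hpin'
  by_contra hcon
  have hcon' : ∀ u, ∃ b, b ≠ a₁ ∧ dist (z₁ b) (q₀ + d • A (P u)) < d / 8 + τ := fun u => by
    by_contra h₁
    exact hcon ⟨u, fun b hb => not_lt.1 fun h₂ => h₁ ⟨b, hb, h₂⟩⟩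
  choose b hb using hcon'
  have hnd : ∀ u, ‖d • A (P u)‖ = d := fun u => by
    rw [norm_smul, LinearIsometry.norm_map, hP1, mul_one, Real.norm_of_nonneg hd.le]
  have hdρ : d ≤ dist (z₁ s₁) (z₁ a₁) + 2 * τ := by
    have h₁ := hpin s₁ hs₁ hs₆
    have h₂ := dist_triangle (z₁ s₁) (z₁ a₁) q₀
    rw [dist_comm (z₁ a₁) q₀] at h₂
    linarith
  have hmd : m₁ ≤ d + 2 * τ := by
    obtain ⟨b₀, hb₀, hb₀'⟩ := hpin'
    linarith [hm b₀ hb₀, dist_triangle (z₁ b₀) q₀ (z₁ a₁)]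
  have hvert : ∀ u, dist (q₀ + d • A (P u)) q₀ = d := fun u => by rw [dist_eq_norm, add_sub_cancel_left, hnd]
  have hnear : ∀ u, dist (z₁ (b u)) (z₁ a₁) ≤ 9 / 8 * (dist (z₁ s₁) (z₁ a₁) + 2 * τ) + 2 * τ := by
    intro u
    linarith [(hb u).2, hvert u, dist_triangle (q₀ + d • A (P u)) q₀ (z₁ a₁), dist_triangle (z₁ (b u)) (q₀ + d • A (P u)) (z₁ a₁)]
  have hbinj : Function.Injective b := by
    intro u v huv
    by_contra hne
    have h₁ := (hb u).2
    have h₂ := (hb v).2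
    rw [huv] at h₁
    have h₅ : dist (q₀ + d • A (P u)) (q₀ + d • A (P v)) = d * dist (P u) (P v) := by
      rw [dist_eq_norm, add_sub_add_left_eq_sub, ← smul_sub, norm_smul, Real.norm_of_nonneg hd.le, ← map_sub, LinearIsometry.norm_map,
        dist_eq_norm]
    have h₃ : d ≤ dist (q₀ + d • A (P u)) (q₀ + d • A (P v)) := by
      rw [h₅]
      nlinarith [hPsep u v hne]
    have h₄ := dist_triangle (q₀ + d • A (P u)) (z₁ (b v)) (q₀ + d • A (P v))
    rw [dist_comm (q₀ + d • A (P u)) (z₁ (b v))] at h₄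
    linarith
  have hS := hcount (Finset.univ.image b) fun x hx => by
    obtain ⟨u, -, rfl⟩ := Finset.mem_image.1 hx
    exact ⟨(hb u).1, hnear u⟩
  rw [Finset.card_image_of_injective _ hbinj, Finset.card_univ, hcard] at hS
  exact lt_irrefl _ hS

/-- **(HT₀) `FixedHoleAt P z₁ c₁ a₁ τ` — the FIXED-CENTRE hole test [WITNESS LEAF · `4` parameters `(d, A)`]**: the hole test with the candidate centre frozen at
`z₁ a₁` and every tolerance doubled.  Coarser than (HT) but a `4`-dimensional branch-and-bound (`d ∈ (0, 3/2]`, `A ∈ O(3)`). -/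
def FixedHoleAt {ι : Type*} (P : ι → E3) {M₁ : ℕ} (z₁ : Fin M₁ → E3) (c₁ a₁ : Fin M₁) (τ : ℝ) : Prop :=
  ∀ (d : ℝ) (A : E3 →ₗᵢ[ℝ] E3), 0 < d → d ≤ 3 / 2 →
    (∀ b, b ≠ a₁ → dist (z₁ b) (z₁ c₁) ≤ 6 → d ≤ dist (z₁ b) (z₁ a₁) + 2 * τ) →
    (∃ b, b ≠ a₁ ∧ dist (z₁ b) (z₁ a₁) ≤ d + 2 * τ) →
      ∃ u, ∀ b, b ≠ a₁ → d / 8 + 2 * τ ≤ dist (z₁ b) (z₁ a₁ + d • A (P u))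

/-- ★ (HT₀) ⟹ (HT): move the candidate centre to `z₁ a₁` at the cost `τ` in every clause. [folklore] -/
theorem holeAt_of_fixedHoleAt {ι : Type*} {P : ι → E3} (h : FixedHoleAt P z₁ c₁ a₁ τ) : HoleAt P z₁ c₁ a₁ τ := by
  intro q₀ d A hq hd hdD hpin hpin'
  have hq' : ∀ b, |dist (z₁ b) q₀ - dist (z₁ b) (z₁ a₁)| ≤ τ := fun b => by
    rw [dist_comm (z₁ b) q₀, dist_comm (z₁ b) (z₁ a₁)]
    exact (abs_dist_sub_le q₀ (z₁ a₁) (z₁ b)).trans hq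
  obtain ⟨u, hu⟩ := h d A hd hdD (fun b hb hb6 => by linarith [hpin b hb hb6, (abs_sub_le_iff.1 (hq' b)).1])
    (by obtain ⟨b, hb, hb'⟩ := hpin'; exact ⟨b, hb, by linarith [(abs_sub_le_iff.1 (hq' b)).2]⟩)
  refine ⟨u, fun b hb => ?_⟩
  have h₁ := hu b hb
  have h₂ : dist (z₁ a₁ + d • A (P u)) (q₀ + d • A (P u)) = dist (z₁ a₁) q₀ := dist_add_right _ _ _
  have h₃ := dist_triangle (z₁ b) (q₀ + d • A (P u)) (z₁ a₁ + d • A (P u))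
  rw [dist_comm (q₀ + d • A (P u)), h₂, dist_comm (z₁ a₁)] at h₃
  linarith

end Loose

end Summit.AtomisticToContinuum.Crystallization.Theorems.FrustratedLawDichotomyStrainedPatchFrameCells
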